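import Summits.QuantumFields.BalabanUV.Beta.GAN24.DerivativeRateTransferJensenMassFreeEnd

/-!
# `BalabanUV.Beta.GAN24.DerivativeRateTransferJensenMassFreeTransfer` — binder row G-an2-4 ∕ (CONV-C), route R6 «VALUES, NOT DERIVATIVES», PART 56:
# THE MASS-FREE END AT FIRST ORDER AND THE CONVENTION TRANSFER — (i) `ε = C·κ`, `δ = 0` for the polar pair at `t = κ`, `r = 1`; (ii) «ONE CONVENTION
# SUFFICES»: a SECOND coarse connection `R″` within `τ` of the polar one (`|(R″ − R′)w| ≤ τ|w|` bond by bond) inherits (STAB-ε,δ) with the additive slack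
# SECOND ORDER IN THE DISCREPANCY, `δ = (1+s⁻¹)·τ²·w_c·d′`, from PART 53's bond-energy bound by one Peter–Paul split (unit b2b-balaban-gan24-p3, gen 43;
# v1; (ii) is the abstract half of gan24-idea-1 g57's LENS ITEM 14 «one convention suffices» — hand-over (s11) TAKEN: the lens's records file
# `records-g57/rec57/ConventionTransferLattice.lean` 71b5bf4730670eab `covJensen_transfer_polarLetters` types the same transfer (credited; written the
# same hour); the SIZE of `τ` for (1.27) ∕ (1.28) — LENS ITEM 14 (B), `ρ ≤ 0.82Δ³` in the block spread — is the lens's, paper, un-typed here)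

NOT IN PRINT; OUR PROOF (for the ROUTE; [folklore] finite-dimensional linear algebra over `ℝ` — PART 21's Peter–Paul, PART 47's in-degree count, PART 53's
`sum_coarseDiff_sq_le_polar` BY NAME).  HONEST FRAMING (cell contract, verbatim): «discharging `BetaPertH` makes Bałaban's UV stability UNCONDITIONAL — a
real constructive-QFT result; it is NOT the continuum limit and NOT the Clay problem.»  HONEST DEPENDENCY (verbatim): «continuum YM on T⁴ ⇐ BetaPertH ∧
nine spine estimates (0/9 proved); BetaPertH ⇐ (D1) ∧ (D4) ∧ CAP+tail; G-an2-4 gates asym, D1 and NE2/3/4.»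

WHY THIS FILE.  (§1) `covJensen_polar_massFree_firstOrder`: PART 53's `covJensen_polar_massFree` at `t = κ ∈ (0,1]`, `r = 1` (`4 − κ² ≥ 3`):
`⟨Qu,H_cQu⟩ ≤ (1 + (1 + 2(1+κ)(1 + 2ϖ + ϖ′))·κ)·⟨u,H_fu⟩` — the relative slack is FIRST ORDER in the holonomy letter and there is no additive term (PART 51's
consistent END at the same ε-order carries `δ = (1+κ)κ³∕2·w_c d′`).  (§2) THE CONVENTION TRANSFER.  Bałaban–Jaffe [Erice 1985, printed p. 221, (1.26)–(1.28)]
list three block averages of the contour variables and remark that the proofs written for (1.28) «also extend to the other two»; PARTs 52–55 type the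
`δ = 0` END for the POLAR one (1.26).  If a second coarse connection `R″` (e.g. (1.27) ∕ (1.28)) satisfies `|(R″_{e′} − R′_{e′})w|² ≤ τ²|w|²` on every coarse
bond, then bond by bond `|R″v(y′) − v(y)|² ≤ (1+s)|R′v(y′) − v(y)|² + (1+s⁻¹)τ²|v(y′)|²` (`sum_coarseDiff_sq_transfer_le`), so ANY bound
`w_cΣ_{e′}|R′(Qu)(tgt′e′) − (Qu)(src′e′)|² ≤ B` transfers to a coarse form built with `R″`: `⟨Qu,H″_cQu⟩ ≤ (1+s)·B + (1+s⁻¹)·τ²·w_c·d′·⟨Qu,Qu⟩`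
(`covJensen_transfer`, in-degree `d′` via PART 47 `sum_tgt_blockMean_le`); with PART 53's `B` this is **`covJensen_transfer_of_polar`**:
  `⟨Qu, H″_cQu⟩ ≤ (1+s)(1 + t + (1+t⁻¹)(1+r)ϖκ² + (1+t⁻¹)(1+r⁻¹)·3κ²(1+ϖ+ϖ′)∕(4−κ²))·⟨u,H_fu⟩ + (1+s⁻¹)·τ²·w_c·d′·⟨Qu,Qu⟩`   for all `s, t, r > 0`,
i.e. (STAB-ε,δ) of PART 20 with `G = QᵀQ` and `δ = (1+s⁻¹)τ²w_c d′` — the additive slack is `τ²`, the SQUARE of the discrepancy between the two conventions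
(for a discrepancy of third order in the plaquette letter, `δ ≍ p̂⁶`), and its Loewner form `posSemidef_covJensen_transfer_of_polar`.

WHAT THIS FILE PROVES (0 sorry, 0 `def`, nothing cited): §1 **`covJensen_polar_massFree_firstOrder`**; §2 `sum_coarseDiff_sq_transfer_le`, **`covJensen_transfer`**,
**`covJensen_transfer_of_polar`**, **`posSemidef_covJensen_transfer_of_polar`**.
WHAT IT DOES NOT DO: bound `τ` for (1.27) ∕ (1.28) against (1.26) (the lens's LENS ITEM 14 estimate; BCH ∕ Karcher-mean analysis — not typed), prove that
the polar factor exists, instantiate anything of Bałaban's, or claim (CONS) ∕ exact (STAB).  SUPPLIER work on route R6 (rank 2, REDUCTION, no seat); no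
consumer of record; NEVER «G-an2-4 closed»; NOT (CONV-C), NOT D1, NOT `BetaPertH`, NOT continuum, NOT Clay.  Records: `HOME/b2b-balaban-gan24-p3/WOODBURY-FIBRE.md` v14.3. -/

noncomputable section

open Matrix Finset

namespace Summit.QuantumFields.BalabanUV.Beta.GAN24.DerivativeRateTransferJensenMassFreeTransfer

open Summit.QuantumFields.BalabanUV.Beta.GAN24.DerivativeRateTransferLoewnerKKT (mulVec_dotProduct_eq)
open Summit.QuantumFields.BalabanUV.Beta.GAN24.DerivativeRateTransferJensenChain
open Summit.QuantumFields.BalabanUV.Beta.GAN24.DerivativeRateTransferJensen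
open Summit.QuantumFields.BalabanUV.Beta.GAN24.DerivativeRateTransferJensenMeanZero
open Summit.QuantumFields.BalabanUV.Beta.GAN24.DerivativeRateTransferJensenMassFreeEnd

section End

variable {o μ ν β β' : Type*} [Fintype o] [DecidableEq o] [Fintype μ] [DecidableEq μ] [Fintype ν] [Fintype β] [DecidableEq β] [Fintype β']
variable {q : μ → ν → ℝ} {W : μ → ν → Matrix o o ℝ} {Q : Matrix (μ × o) (ν × o) ℝ}
variable {src tgt : β → ν} {R : β → Matrix o o ℝ} {src' tgt' : β' → μ} {R' R'' : β' → Matrix o o ℝ}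
variable {Hf : Matrix (ν × o) (ν × o) ℝ} {Hc : Matrix (μ × o) (μ × o) ℝ} {wf wc : ℝ}
variable {σ : β' → ν ≃ ν} {ℓ : ℕ} {xs : β' → ν → ℕ → ν} {γ : β' → ν → ℕ → β} {T : β' → ν → ℕ → Matrix o o ℝ} {m : ℝ}
variable {N : β' → ν → Matrix o o ℝ} {Φ : (ν × o → ℝ) → μ → ℝ} {ϖ ϖ' κ τ d' B : ℝ}

/-! ## §1 The polar END at first order -/

omit [DecidableEq μ] in
/-- **`covJensen_polar_massFree_firstOrder` — `ε = C·κ`, `δ = 0`** [our proof]: at `t = κ ∈ (0,1]`, `r = 1` (so `4 − κ² ≥ 3`), with `0 ≤ ϖ, ϖ′`: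
`⟨Qu, H_cQu⟩ ≤ (1 + (1 + 2(1+κ)(1 + 2ϖ + ϖ′))·κ)·⟨u, H_f u⟩` (when `0 ≤ ⟨u,H_fu⟩`, e.g. `H_f` positive semidefinite). -/
theorem covJensen_polar_massFree_firstOrder
    (hq : ∀ y x, 0 ≤ q y x) (hq1 : ∀ y, ∑ x, q y x = 1) (hW : ∀ y x, (W y x)ᵀ * W y x = 1) (hR : ∀ e, (R e)ᵀ * R e = 1)
    (hR' : ∀ e', (R' e')ᵀ * R' e' = 1)
    (hQ : ∀ (u : ν × o → ℝ) (y : μ), (fun a => (Q *ᵥ u) (y, a)) = ∑ x, q y x • (W y x *ᵥ fun b => u (x, b)))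
    (hwc : 0 ≤ wc)
    (hHc : ∀ v : μ × o → ℝ, v ⬝ᵥ (Hc *ᵥ v) ≤
      wc * ∑ e', ((R' e' *ᵥ fun a => v (tgt' e', a)) - fun a => v (src' e', a)) ⬝ᵥ
        ((R' e' *ᵥ fun a => v (tgt' e', a)) - fun a => v (src' e', a)))
    (hHf : ∀ u : ν × o → ℝ, wf * ∑ e, ((R e *ᵥ fun b => u (tgt e, b)) - fun b => u (src e, b)) ⬝ᵥ
        ((R e *ᵥ fun b => u (tgt e, b)) - fun b => u (src e, b)) ≤ u ⬝ᵥ (Hf *ᵥ u))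
    (hσq : ∀ e' x, q (tgt' e') (σ e' x) = q (src' e') x)
    (hx0 : ∀ e' x, xs e' x 0 = x) (hxℓ : ∀ e' x, xs e' x ℓ = σ e' x)
    (hsrc : ∀ e' x i, i < ℓ → src (γ e' x i) = xs e' x i) (htgt : ∀ e' x i, i < ℓ → tgt (γ e' x i) = xs e' x (i + 1))
    (hT0 : ∀ e' x, T e' x 0 = 1) (hT : ∀ e' x i, i < ℓ → T e' x (i + 1) = T e' x i * R (γ e' x i))
    (hmult : ∀ e, ∑ e', ∑ x, ∑ i ∈ range ℓ, (if γ e' x i = e then q (src' e') x else 0) ≤ m)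
    (hw : wc * ℓ * m ≤ wf)
    (hNdef : ∀ e' x, N e' x = 1 - W (src' e') x * T e' x ℓ * (W (tgt' e') (σ e' x))ᵀ * (R' e')ᵀ)
    (hN : ∀ e' x (w : o → ℝ), (N e' x *ᵥ w) ⬝ᵥ (N e' x *ᵥ w) ≤ κ ^ 2 * (w ⬝ᵥ w))
    (hsym : ∀ e', (∑ x, q (src' e') x • N e' x)ᵀ = ∑ x, q (src' e') x • N e' x)
    (u : ν × o → ℝ)
    (hP : ∀ y, ∑ x, q y x * (((W y x *ᵥ fun b => u (x, b)) - fun a => (Q *ᵥ u) (y, a)) ⬝ᵥ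
        ((W y x *ᵥ fun b => u (x, b)) - fun a => (Q *ᵥ u) (y, a))) ≤ Φ u y)
    (hΦ : wc * ∑ e', Φ u (tgt' e') ≤ ϖ * (u ⬝ᵥ (Hf *ᵥ u))) (hΦ' : wc * ∑ e', Φ u (src' e') ≤ ϖ' * (u ⬝ᵥ (Hf *ᵥ u)))
    (hκ : 0 < κ) (hκ1 : κ ≤ 1) (hϖ : 0 ≤ ϖ) (hϖ' : 0 ≤ ϖ') (hHf0 : 0 ≤ u ⬝ᵥ (Hf *ᵥ u)) :
    (Q *ᵥ u) ⬝ᵥ (Hc *ᵥ (Q *ᵥ u)) ≤ (1 + (1 + 2 * (1 + κ) * (1 + 2 * ϖ + ϖ')) * κ) * (u ⬝ᵥ (Hf *ᵥ u)) := by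
  have hκ4 : κ ^ 2 < 4 := by nlinarith
  have h := covJensen_polar_massFree hq hq1 hW hR hR' hQ hwc hHc hHf hσq hx0 hxℓ hsrc htgt hT0 hT hmult hw hNdef hN hsym hκ4 u hP hΦ hΦ'
    (t := κ) (r := 1) hκ one_pos
  refine h.trans (mul_le_mul_of_nonneg_right ?_ hHf0)
  -- compare the coefficients: `(1+κ⁻¹)κ² = (1+κ)κ`, `3κ²∕(4 − κ²) ≤ κ²` since `4 − κ² ≥ 3`
  have hk : (1 + κ⁻¹) * κ ^ 2 = (1 + κ) * κ := by field_simp; ring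
  have hκsq : κ ^ 2 ≤ 1 := by nlinarith [mul_le_mul_of_nonneg_left hκ1 hκ.le]
  have h3 : 3 * κ ^ 2 / (4 - κ ^ 2) ≤ κ ^ 2 := by
    rw [div_le_iff₀ (by nlinarith)]
    nlinarith [mul_le_mul_of_nonneg_left hκsq (sq_nonneg κ)]
  have hmono : (1 + κ⁻¹) * (1 + (1 : ℝ)⁻¹) * (3 * κ ^ 2 / (4 - κ ^ 2)) * (1 + ϖ + ϖ') ≤
      (1 + κ⁻¹) * (1 + (1 : ℝ)⁻¹) * κ ^ 2 * (1 + ϖ + ϖ') := by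
    have hA : 0 ≤ (1 + κ⁻¹) * (1 + (1 : ℝ)⁻¹) := by positivity
    have hB : 0 ≤ 1 + ϖ + ϖ' := by linarith
    exact mul_le_mul_of_nonneg_right (mul_le_mul_of_nonneg_left h3 hA) hB
  calc 1 + κ + (1 + κ⁻¹) * (1 + 1) * ϖ * κ ^ 2 + (1 + κ⁻¹) * (1 + (1 : ℝ)⁻¹) * (3 * κ ^ 2 / (4 - κ ^ 2)) * (1 + ϖ + ϖ')
      ≤ 1 + κ + (1 + κ⁻¹) * (1 + 1) * ϖ * κ ^ 2 + (1 + κ⁻¹) * (1 + (1 : ℝ)⁻¹) * κ ^ 2 * (1 + ϖ + ϖ') := by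
        linarith [hmono]
    _ = 1 + (1 + 2 * (1 + κ) * (1 + 2 * ϖ + ϖ')) * κ := by
        rw [inv_one]
        have e : (1 + κ⁻¹) * κ ^ 2 = (1 + κ) * κ := hk
        calc 1 + κ + (1 + κ⁻¹) * (1 + 1) * ϖ * κ ^ 2 + (1 + κ⁻¹) * (1 + 1) * κ ^ 2 * (1 + ϖ + ϖ')
            = 1 + κ + 2 * ϖ * ((1 + κ⁻¹) * κ ^ 2) + 2 * (1 + ϖ + ϖ') * ((1 + κ⁻¹) * κ ^ 2) := by ring
          _ = 1 + (1 + 2 * (1 + κ) * (1 + 2 * ϖ + ϖ')) * κ := by rw [e]; ring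

/-! ## §2 The convention transfer: a second coarse connection within `τ` of the polar one -/

omit [DecidableEq o] [Fintype μ] [DecidableEq μ] [Fintype ν] [Fintype β] [DecidableEq β] in
/-- **`sum_coarseDiff_sq_transfer_le`** — bond by bond Peter–Paul: `|(R″ − R′)w|² ≤ τ²|w|²` on every coarse bond ⟹ for every coarse field `v` and `s > 0`,
`Σ_{e′}|R″v(tgt′) − v(src′)|² ≤ (1+s)·Σ_{e′}|R′v(tgt′) − v(src′)|² + (1+s⁻¹)·τ²·Σ_{e′}|v(tgt′e′)|²`. [folklore] -/
theorem sum_coarseDiff_sq_transfer_le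
    (hτ : ∀ e' (w : o → ℝ), ((R'' e' - R' e') *ᵥ w) ⬝ᵥ ((R'' e' - R' e') *ᵥ w) ≤ τ ^ 2 * (w ⬝ᵥ w))
    (v : μ × o → ℝ) {s : ℝ} (hs : 0 < s) :
    ∑ e', ((R'' e' *ᵥ fun a => v (tgt' e', a)) - fun a => v (src' e', a)) ⬝ᵥ ((R'' e' *ᵥ fun a => v (tgt' e', a)) - fun a => v (src' e', a)) ≤
      (1 + s) * ∑ e', ((R' e' *ᵥ fun a => v (tgt' e', a)) - fun a => v (src' e', a)) ⬝ᵥ ((R' e' *ᵥ fun a => v (tgt' e', a)) - fun a => v (src' e', a)) +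
        (1 + s⁻¹) * (τ ^ 2 * ∑ e', (fun a => v (tgt' e', a)) ⬝ᵥ fun a => v (tgt' e', a)) := by
  rw [Finset.mul_sum, Finset.mul_sum, Finset.mul_sum, ← Finset.sum_add_distrib]
  refine Finset.sum_le_sum fun e' _ => ?_
  have e : (R'' e' *ᵥ fun a => v (tgt' e', a)) - (fun a => v (src' e', a)) =
      ((R' e' *ᵥ fun a => v (tgt' e', a)) - fun a => v (src' e', a)) + (R'' e' - R' e') *ᵥ fun a => v (tgt' e', a) := by
    rw [sub_mulVec]; abel
  rw [e]
  refine (dotProduct_self_add_le _ _ hs).trans ?_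
  have hs' : (0 : ℝ) ≤ 1 + s⁻¹ := by positivity
  have h2 := mul_le_mul_of_nonneg_left (hτ e' fun a => v (tgt' e', a)) hs'
  linarith

omit [DecidableEq o] [Fintype β] [DecidableEq β] in
/-- **`covJensen_transfer` — ONE CONVENTION SUFFICES, ABSTRACTLY** [our proof]: a bound `w_c·Σ_{e′}|R′(Qu)(tgt′e′) − (Qu)(src′e′)|² ≤ B` for ONE coarse
connection `R′`, a second connection with `|(R″ − R′)w|² ≤ τ²|w|²` bond by bond, a coarse form `H_c ≤ w_c·Σ_{e′}|R″v(tgt′) − v(src′)|²` (`0 ≤ w_c`) and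
in-degree `≤ d′` ⟹ for every `s > 0`: `⟨Qu, H_cQu⟩ ≤ (1+s)·B + (1+s⁻¹)·τ²·w_c·d′·⟨Qu,Qu⟩`. -/
theorem covJensen_transfer (hwc : 0 ≤ wc)
    (hHc : ∀ v : μ × o → ℝ, v ⬝ᵥ (Hc *ᵥ v) ≤
      wc * ∑ e', ((R'' e' *ᵥ fun a => v (tgt' e', a)) - fun a => v (src' e', a)) ⬝ᵥ
        ((R'' e' *ᵥ fun a => v (tgt' e', a)) - fun a => v (src' e', a)))
    (hτ : ∀ e' (w : o → ℝ), ((R'' e' - R' e') *ᵥ w) ⬝ᵥ ((R'' e' - R' e') *ᵥ w) ≤ τ ^ 2 * (w ⬝ᵥ w))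
    (hdeg : ∀ y, ((Finset.univ.filter fun e' => tgt' e' = y).card : ℝ) ≤ d')
    (u : ν × o → ℝ)
    (hB : wc * ∑ e', ((R' e' *ᵥ fun a => (Q *ᵥ u) (tgt' e', a)) - fun a => (Q *ᵥ u) (src' e', a)) ⬝ᵥ
        ((R' e' *ᵥ fun a => (Q *ᵥ u) (tgt' e', a)) - fun a => (Q *ᵥ u) (src' e', a)) ≤ B)
    {s : ℝ} (hs : 0 < s) :
    (Q *ᵥ u) ⬝ᵥ (Hc *ᵥ (Q *ᵥ u)) ≤ (1 + s) * B + (1 + s⁻¹) * τ ^ 2 * wc * d' * ((Q *ᵥ u) ⬝ᵥ (Q *ᵥ u)) := by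
  have h1 := sum_coarseDiff_sq_transfer_le (src' := src') (tgt' := tgt') hτ (Q *ᵥ u) hs
  have hgr := sum_tgt_blockMean_le (tgt' := tgt') hdeg (Q *ᵥ u)
  have hs' : (0 : ℝ) ≤ 1 + s⁻¹ := by positivity
  refine (hHc _).trans ?_
  refine (mul_le_mul_of_nonneg_left h1 hwc).trans ?_
  have h3 : wc * ((1 + s⁻¹) * (τ ^ 2 * ∑ e', (fun a => (Q *ᵥ u) (tgt' e', a)) ⬝ᵥ fun a => (Q *ᵥ u) (tgt' e', a))) ≤
      (1 + s⁻¹) * τ ^ 2 * wc * d' * ((Q *ᵥ u) ⬝ᵥ (Q *ᵥ u)) := by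
    have : wc * ((1 + s⁻¹) * (τ ^ 2 * ∑ e', (fun a => (Q *ᵥ u) (tgt' e', a)) ⬝ᵥ fun a => (Q *ᵥ u) (tgt' e', a))) =
        (1 + s⁻¹) * τ ^ 2 * wc * ∑ e', (fun a => (Q *ᵥ u) (tgt' e', a)) ⬝ᵥ fun a => (Q *ᵥ u) (tgt' e', a) := by ring
    rw [this]
    have := mul_le_mul_of_nonneg_left hgr (show (0 : ℝ) ≤ (1 + s⁻¹) * τ ^ 2 * wc by positivity)
    linarith [this]
  have h4 : wc * ((1 + s) * ∑ e', ((R' e' *ᵥ fun a => (Q *ᵥ u) (tgt' e', a)) - fun a => (Q *ᵥ u) (src' e', a)) ⬝ᵥ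
      ((R' e' *ᵥ fun a => (Q *ᵥ u) (tgt' e', a)) - fun a => (Q *ᵥ u) (src' e', a))) ≤ (1 + s) * B := by
    have : wc * ((1 + s) * ∑ e', ((R' e' *ᵥ fun a => (Q *ᵥ u) (tgt' e', a)) - fun a => (Q *ᵥ u) (src' e', a)) ⬝ᵥ
        ((R' e' *ᵥ fun a => (Q *ᵥ u) (tgt' e', a)) - fun a => (Q *ᵥ u) (src' e', a))) =
      (1 + s) * (wc * ∑ e', ((R' e' *ᵥ fun a => (Q *ᵥ u) (tgt' e', a)) - fun a => (Q *ᵥ u) (src' e', a)) ⬝ᵥ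
        ((R' e' *ᵥ fun a => (Q *ᵥ u) (tgt' e', a)) - fun a => (Q *ᵥ u) (src' e', a))) := by ring
    rw [this]
    exact mul_le_mul_of_nonneg_left hB (by linarith)
  rw [mul_add]
  linarith [h3, h4]

/-- **`covJensen_transfer_of_polar` — ONE CONVENTION SUFFICES** [our proof]: the hypotheses of PART 53's `sum_coarseDiff_sq_le_polar` for the POLAR
connection `R′` (block weights with `Σ = 1`, orthogonal `W, R, R′`, `hQ`, `hHf`, pairing, chains, `hNdef ∕ hN ∕ hsym`, `κ² < 4`, Poincaré budgets `ϖ, ϖ′`),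
a SECOND coarse connection `R″` with `|(R″ − R′)w|² ≤ τ²|w|²` on every bond, a coarse form `H_c ≤ w_c·Σ_{e′}|R″v(tgt′) − v(src′)|²`, and in-degree `≤ d′`
⟹ for all `s, t, r > 0`:
`⟨Qu, H_cQu⟩ ≤ (1+s)(1 + t + (1+t⁻¹)(1+r)ϖκ² + (1+t⁻¹)(1+r⁻¹)·3κ²(1+ϖ+ϖ′)∕(4−κ²))·⟨u,H_fu⟩ + (1+s⁻¹)·τ²·w_c·d′·⟨Qu,Qu⟩` — (STAB-ε,δ) with
`δ = (1+s⁻¹)τ²w_c d′`, SECOND ORDER in the discrepancy of the conventions. -/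
theorem covJensen_transfer_of_polar
    (hq : ∀ y x, 0 ≤ q y x) (hq1 : ∀ y, ∑ x, q y x = 1) (hW : ∀ y x, (W y x)ᵀ * W y x = 1) (hR : ∀ e, (R e)ᵀ * R e = 1)
    (hR' : ∀ e', (R' e')ᵀ * R' e' = 1)
    (hQ : ∀ (u : ν × o → ℝ) (y : μ), (fun a => (Q *ᵥ u) (y, a)) = ∑ x, q y x • (W y x *ᵥ fun b => u (x, b)))
    (hwc : 0 ≤ wc)
    (hHc : ∀ v : μ × o → ℝ, v ⬝ᵥ (Hc *ᵥ v) ≤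
      wc * ∑ e', ((R'' e' *ᵥ fun a => v (tgt' e', a)) - fun a => v (src' e', a)) ⬝ᵥ
        ((R'' e' *ᵥ fun a => v (tgt' e', a)) - fun a => v (src' e', a)))
    (hτ : ∀ e' (w : o → ℝ), ((R'' e' - R' e') *ᵥ w) ⬝ᵥ ((R'' e' - R' e') *ᵥ w) ≤ τ ^ 2 * (w ⬝ᵥ w))
    (hHf : ∀ u : ν × o → ℝ, wf * ∑ e, ((R e *ᵥ fun b => u (tgt e, b)) - fun b => u (src e, b)) ⬝ᵥ
        ((R e *ᵥ fun b => u (tgt e, b)) - fun b => u (src e, b)) ≤ u ⬝ᵥ (Hf *ᵥ u))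
    (hσq : ∀ e' x, q (tgt' e') (σ e' x) = q (src' e') x)
    (hx0 : ∀ e' x, xs e' x 0 = x) (hxℓ : ∀ e' x, xs e' x ℓ = σ e' x)
    (hsrc : ∀ e' x i, i < ℓ → src (γ e' x i) = xs e' x i) (htgt : ∀ e' x i, i < ℓ → tgt (γ e' x i) = xs e' x (i + 1))
    (hT0 : ∀ e' x, T e' x 0 = 1) (hT : ∀ e' x i, i < ℓ → T e' x (i + 1) = T e' x i * R (γ e' x i))
    (hmult : ∀ e, ∑ e', ∑ x, ∑ i ∈ range ℓ, (if γ e' x i = e then q (src' e') x else 0) ≤ m)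
    (hw : wc * ℓ * m ≤ wf)
    (hNdef : ∀ e' x, N e' x = 1 - W (src' e') x * T e' x ℓ * (W (tgt' e') (σ e' x))ᵀ * (R' e')ᵀ)
    (hN : ∀ e' x (w : o → ℝ), (N e' x *ᵥ w) ⬝ᵥ (N e' x *ᵥ w) ≤ κ ^ 2 * (w ⬝ᵥ w))
    (hsym : ∀ e', (∑ x, q (src' e') x • N e' x)ᵀ = ∑ x, q (src' e') x • N e' x) (hκ : κ ^ 2 < 4)
    (hdeg : ∀ y, ((Finset.univ.filter fun e' => tgt' e' = y).card : ℝ) ≤ d')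
    (u : ν × o → ℝ)
    (hP : ∀ y, ∑ x, q y x * (((W y x *ᵥ fun b => u (x, b)) - fun a => (Q *ᵥ u) (y, a)) ⬝ᵥ
        ((W y x *ᵥ fun b => u (x, b)) - fun a => (Q *ᵥ u) (y, a))) ≤ Φ u y)
    (hΦ : wc * ∑ e', Φ u (tgt' e') ≤ ϖ * (u ⬝ᵥ (Hf *ᵥ u))) (hΦ' : wc * ∑ e', Φ u (src' e') ≤ ϖ' * (u ⬝ᵥ (Hf *ᵥ u)))
    {s t r : ℝ} (hs : 0 < s) (ht : 0 < t) (hr : 0 < r) :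
    (Q *ᵥ u) ⬝ᵥ (Hc *ᵥ (Q *ᵥ u)) ≤
      (1 + s) * ((1 + t + (1 + t⁻¹) * (1 + r) * ϖ * κ ^ 2 + (1 + t⁻¹) * (1 + r⁻¹) * (3 * κ ^ 2 / (4 - κ ^ 2)) * (1 + ϖ + ϖ')) *
        (u ⬝ᵥ (Hf *ᵥ u))) + (1 + s⁻¹) * τ ^ 2 * wc * d' * ((Q *ᵥ u) ⬝ᵥ (Q *ᵥ u)) :=
  covJensen_transfer hwc hHc hτ hdeg u
    (sum_coarseDiff_sq_le_polar hq hq1 hW hR hR' hQ hwc hHf hσq hx0 hxℓ hsrc htgt hT0 hT hmult hw hNdef hN hsym hκ u hP hΦ hΦ' ht hr) hs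

/-- **`posSemidef_covJensen_transfer_of_polar` — THE TRANSFERRED (STAB-ε,δ) AS PART 20 CONSUMES IT** (`G = QᵀQ`, `δ = (1+s⁻¹)τ²w_c d′`) [our proof]: under
the hypotheses of `covJensen_transfer_of_polar` for every `u`, with `H_f`, `H_c` symmetric, for all `s, t, r > 0`:
`((1+s)(1 + t + (1+t⁻¹)(1+r)ϖκ² + (1+t⁻¹)(1+r⁻¹)·3κ²(1+ϖ+ϖ′)∕(4−κ²))•H_f + ((1+s⁻¹)τ²w_c d′)•(QᵀQ) − QᵀH_cQ).PosSemidef`. -/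
theorem posSemidef_covJensen_transfer_of_polar [DecidableEq ν]
    (hq : ∀ y x, 0 ≤ q y x) (hq1 : ∀ y, ∑ x, q y x = 1) (hW : ∀ y x, (W y x)ᵀ * W y x = 1) (hR : ∀ e, (R e)ᵀ * R e = 1)
    (hR' : ∀ e', (R' e')ᵀ * R' e' = 1)
    (hQ : ∀ (u : ν × o → ℝ) (y : μ), (fun a => (Q *ᵥ u) (y, a)) = ∑ x, q y x • (W y x *ᵥ fun b => u (x, b)))
    (hwc : 0 ≤ wc) (hHfs : Hfᵀ = Hf) (hHcs : Hcᵀ = Hc)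
    (hHc : ∀ v : μ × o → ℝ, v ⬝ᵥ (Hc *ᵥ v) ≤
      wc * ∑ e', ((R'' e' *ᵥ fun a => v (tgt' e', a)) - fun a => v (src' e', a)) ⬝ᵥ
        ((R'' e' *ᵥ fun a => v (tgt' e', a)) - fun a => v (src' e', a)))
    (hτ : ∀ e' (w : o → ℝ), ((R'' e' - R' e') *ᵥ w) ⬝ᵥ ((R'' e' - R' e') *ᵥ w) ≤ τ ^ 2 * (w ⬝ᵥ w))
    (hHf : ∀ u : ν × o → ℝ, wf * ∑ e, ((R e *ᵥ fun b => u (tgt e, b)) - fun b => u (src e, b)) ⬝ᵥ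
        ((R e *ᵥ fun b => u (tgt e, b)) - fun b => u (src e, b)) ≤ u ⬝ᵥ (Hf *ᵥ u))
    (hσq : ∀ e' x, q (tgt' e') (σ e' x) = q (src' e') x)
    (hx0 : ∀ e' x, xs e' x 0 = x) (hxℓ : ∀ e' x, xs e' x ℓ = σ e' x)
    (hsrc : ∀ e' x i, i < ℓ → src (γ e' x i) = xs e' x i) (htgt : ∀ e' x i, i < ℓ → tgt (γ e' x i) = xs e' x (i + 1))
    (hT0 : ∀ e' x, T e' x 0 = 1) (hT : ∀ e' x i, i < ℓ → T e' x (i + 1) = T e' x i * R (γ e' x i))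
    (hmult : ∀ e, ∑ e', ∑ x, ∑ i ∈ range ℓ, (if γ e' x i = e then q (src' e') x else 0) ≤ m)
    (hw : wc * ℓ * m ≤ wf)
    (hNdef : ∀ e' x, N e' x = 1 - W (src' e') x * T e' x ℓ * (W (tgt' e') (σ e' x))ᵀ * (R' e')ᵀ)
    (hN : ∀ e' x (w : o → ℝ), (N e' x *ᵥ w) ⬝ᵥ (N e' x *ᵥ w) ≤ κ ^ 2 * (w ⬝ᵥ w))
    (hsym : ∀ e', (∑ x, q (src' e') x • N e' x)ᵀ = ∑ x, q (src' e') x • N e' x) (hκ : κ ^ 2 < 4)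
    (hdeg : ∀ y, ((Finset.univ.filter fun e' => tgt' e' = y).card : ℝ) ≤ d')
    (hP : ∀ (u : ν × o → ℝ) y, ∑ x, q y x * (((W y x *ᵥ fun b => u (x, b)) - fun a => (Q *ᵥ u) (y, a)) ⬝ᵥ
        ((W y x *ᵥ fun b => u (x, b)) - fun a => (Q *ᵥ u) (y, a))) ≤ Φ u y)
    (hΦ : ∀ u : ν × o → ℝ, wc * ∑ e', Φ u (tgt' e') ≤ ϖ * (u ⬝ᵥ (Hf *ᵥ u)))
    (hΦ' : ∀ u : ν × o → ℝ, wc * ∑ e', Φ u (src' e') ≤ ϖ' * (u ⬝ᵥ (Hf *ᵥ u)))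
    {s t r : ℝ} (hs : 0 < s) (ht : 0 < t) (hr : 0 < r) :
    (((1 + s) * (1 + t + (1 + t⁻¹) * (1 + r) * ϖ * κ ^ 2 + (1 + t⁻¹) * (1 + r⁻¹) * (3 * κ ^ 2 / (4 - κ ^ 2)) * (1 + ϖ + ϖ'))) • Hf +
      ((1 + s⁻¹) * τ ^ 2 * wc * d') • (Qᵀ * Q) - Qᵀ * Hc * Q).PosSemidef := by
  refine PosSemidef.of_dotProduct_mulVec_nonneg ?_ fun u => ?_
  · rw [Matrix.IsHermitian, Matrix.conjTranspose_eq_transpose_of_trivial, transpose_sub, transpose_add, transpose_smul, transpose_smul,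
      transpose_mul, transpose_transpose, hHfs, transpose_mul, transpose_mul, transpose_transpose, hHcs, Matrix.mul_assoc]
  · simp only [star_trivial, sub_mulVec, add_mulVec, dotProduct_sub, dotProduct_add, smul_mulVec, dotProduct_smul, smul_eq_mul, sub_nonneg]
    have e1 : u ⬝ᵥ ((Qᵀ * Hc * Q) *ᵥ u) = (Q *ᵥ u) ⬝ᵥ (Hc *ᵥ (Q *ᵥ u)) := by
      rw [mulVec_dotProduct_eq, mulVec_mulVec, mulVec_mulVec, Matrix.mul_assoc]
    have e2 : u ⬝ᵥ ((Qᵀ * Q) *ᵥ u) = (Q *ᵥ u) ⬝ᵥ (Q *ᵥ u) := by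
      rw [mulVec_dotProduct_eq, mulVec_mulVec]
    rw [e1, e2]
    have h := covJensen_transfer_of_polar hq hq1 hW hR hR' hQ hwc hHc hτ hHf hσq hx0 hxℓ hsrc htgt hT0 hT hmult hw hNdef hN hsym hκ hdeg u (hP u)
      (hΦ u) (hΦ' u) hs ht hr
    refine h.trans (le_of_eq ?_)
    ring

end End

end Summit.QuantumFields.BalabanUV.Beta.GAN24.DerivativeRateTransferJensenMassFreeTransfer

end
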